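import Summits.HodgeConjecture.HodgeConjecture.Theorems.CyclicUnitaryPowersNodalMeridianMonodromy
import Summits.HodgeConjecture.HodgeConjecture.Theorems.CyclicUnitaryPowersFermatGeometricGenusBound
import HarnessLib

/-!
# K1-A ⟸ CDK alone: the crux `VeryGeneralDeckCommutatorsInHg` from the single remaining named fact
# (route `CyclicUnitaryPowers`, item stmt-HodgeConjecture-19544)

Prover seat `hodge-nonav-prover-Ax` (g10), cell `hodge-nonav`. Helper file `--supports stmt-HodgeConjecture-19544`; sorry-free; no
definition, no new named fact. CONDITIONAL result: nothing here says HC ∕ HC_AV is proved; rung F-H1 not moved.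

With F1‡ `carlsonToledo1999_nodalMeridianLocalMonodromyBound` now a THEOREM (`carlsonToledo1999_nodalMeridianLocalMonodromyBound_holds`,
programme "localisation") and the geometric-genus input discharged by the prover seat Bx (`hodgeNumber_two_zero_fermat_le`), the
conditional assembly `veryGeneralDeckCommutatorsInHg_of_localMonodromyBound_cdk` of K1-A depends on ONE published theorem only:
`cmsp_nonHodgeGenericPoints_countable_algebraic_cover` (CDK — Cattani–Deligne–Kaplan 1995 Thm. 1.1: the locus of Hodge classes is a
countable union of algebraic subvarieties). This file records the two corollaries.

## References

* [CarlsonToledo1999] J. A. Carlson, D. Toledo, Duke Math. J. 97 (1999), §2, §5, §6 (kdoublept), §7 Theorem 7.1.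
* [CattaniDeligneKaplan1995] E. Cattani, P. Deligne, A. Kaplan, On the locus of Hodge classes, J. Amer. Math. Soc. 8 (1995), Thm. 1.1, Cor. 1.2.
-/

set_option linter.dupNamespace false

noncomputable section

open Literature.AlgebraicGeometry.HodgeTheory
open Summit.HodgeConjecture.HodgeConjecture.Theorems.CyclicUnitaryPowersNodalMeridianMonodromy
open Summit.HodgeConjecture.HodgeConjecture.Theorems.CyclicUnitaryPowersFermatGeometricGenusBound

namespace Summit.HodgeConjecture.HodgeConjecture.Theorems.CyclicUnitaryPowersK1OfCDK

/-- **K1-A ⟸ CDK.** The crux `VeryGeneralDeckCommutatorsInHg` of route `CyclicUnitaryPowers` from the Cattani–Deligne–Kaplan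
theorem alone (F1‡ proved, geometric genus proved). CONDITIONAL on CDK. [cite: CarlsonToledo1999, §6 (kdoublept) and §7 Theorem 7.1]
[cite: CattaniDeligneKaplan1995, Thm. 1.1 and Cor. 1.2] -/
theorem veryGeneralDeckCommutatorsInHg_of_cdk (hCDK : cmsp_nonHodgeGenericPoints_countable_algebraic_cover) :
    Summit.HodgeConjecture.HodgeConjecture.Theses.CyclicUnitaryPowers.VeryGeneralDeckCommutatorsInHg := by
  exact veryGeneralDeckCommutatorsInHg_of_localMonodromyBound_cdk carlsonToledo1999_nodalMeridianLocalMonodromyBound_holds @hCDK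

/-- **The rung leaf `CyclicSurfacePowersHodge` ⟸ CDK.** CONDITIONAL on CDK; rung F-H1 not moved.
[cite: CarlsonToledo1999, §6 (kdoublept) and §7 Theorem 7.1] [cite: CattaniDeligneKaplan1995, Thm. 1.1 and Cor. 1.2] -/
theorem cyclicSurfacePowersHodge_of_cdk (hCDK : cmsp_nonHodgeGenericPoints_countable_algebraic_cover) :
    Summit.HodgeConjecture.HodgeConjecture.Theses.CyclicUnitaryPowers.CyclicSurfacePowersHodge := by
  exact cyclicSurfacePowersHodge_of_localMonodromyBound_cdk carlsonToledo1999_nodalMeridianLocalMonodromyBound_holds @hCDK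

end Summit.HodgeConjecture.HodgeConjecture.Theorems.CyclicUnitaryPowersK1OfCDK

end
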